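import Literature.MathematicalPhysics.QuantumLattice.HubbardTorusClusterEnergyRepresentative
import HarnessLib

/-!
# The certified Markov upper bound on the grand-canonical Hubbard pressure with a weighted-cluster
# (bond) energy representative — windows that need only contain a corner `{a, a − e₁, …, a − e_d}`

Topic `MathematicalPhysics/QuantumLattice`, namespace `Literature.MathematicalPhysics.QuantumLattice`.

`HubbardTorusMarkovPressureBound.lean` instantiates the abstract Markov pressure certificate
(`torus_log_partitionFn_le_of_certificate`) for the `t–t'` Hubbard torus with the energy representative
`Γ(τ_z E_Φ)`, which forces the window `Λ` to contain a `3 × 3` translate. The certificates actually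
produced by the free-energy programme (`hubbard-thermal`, certificate C1) live on `3 × 2`, `4 × 2` and
staircase windows and use instead the CORNER representative
`h_μ = U n_{a↑}n_{a↓} − μ n_a − t Σ_i hop(a − e_i, a)` (each site owns the bonds towards its corner) plus an
annihilator `G = Σ_i g_i (O_i − τ_{z_i} O_i)`. With the energy identity and the annihilator of
`HubbardTorusClusterEnergyRepresentative.lean` this file proves the finite-volume reader theorem for every
WEIGHTED-CLUSTER representative, for the pure Hubbard model (`t' = 0`) on `(ℤ/Lℤ)^d`, `L ≥ 3`, any `d`:

* §1 `hubbardWith_log_partitionFn_le_of_clusterCertificate`: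
  `log Z_β(H_L − μN_L) ≤ L^d · c + (L^d − (L+1−ℓ)^d) · (log 4 − c − β e)` from the matrix certificate
  `e^c · exp(L_B) − tr_{Λ→Λ∖a} exp(−β (h(J,V,μ') + G) + Γ L_B) ⪰ 0`, with `G` any Hermitian element of zero
  window expectation — in particular a `windowAnnihilator` (`…_of_clusterCertificate_annihilator`: then the
  matrix certificate is the ONLY hypothesis);
* §2 the `d = 2`, `t' = 0` corollary for `hubbardTorusTT' L t 0 U − μ N` (the object of the torus-limit
  files `HubbardTorusMarkovPressureTorusLimit.lean` / `TorusSectorGibbsEnergyWindow.lean`).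

Mathematics: Markov-entropy-decomposition bound with a rational dual [cite: PoulinHastings2011, eqs. (3)–(8)],
cluster bookkeeping [cite: Anderson1951, eq. (2)]. Everything is PROVED; no definition, no named fact.
-/

noncomputable section

namespace Literature.MathematicalPhysics.QuantumLattice

open Matrix Finset HubbardWave0 Literature.Probability.LatticeModels AndersonCluster
open scoped ComplexOrder

/-! ### §0. Corner weights: the programme's representative `U n_{a↑}n_{a↓} − μ n_a − t Σ_i hop(a − eᵢ, a)` -/

section Corner

variable {d : ℕ}

/-- **Corner bond weights**: the bond `(x, x + eᵢ)` carries weight `1` iff its far endpoint is the corner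
`a` (i.e. `x = a − eᵢ`), else `0` — "the corner owns the bonds pointing into it". [cite: Anderson1951, eq. (2)] -/
def cornerBondWeight (a : Site d) : Site d → Fin d → ℝ := fun x i => if x + unitVec i = a then 1 else 0

/-- **Corner site weight**: `1` at the corner `a`, `0` elsewhere. [cite: Anderson1951, eq. (2)] -/
def cornerSiteWeight (a : Site d) : Site d → ℝ := fun x => if x = a then 1 else 0

/-- The corner bond weights are normalised in direction `i` as soon as the window contains `a` and
`a − eᵢ`: `Σ_{x ∈ Λ} J̃(x,i) = 1`. [cite: Anderson1951, eq. (2)] -/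
theorem bondWeightSum_cornerBondWeight {Λ : Finset (Site d)} {a : Site d} (ha : a ∈ Λ) {i : Fin d}
    (hai : a - unitVec i ∈ Λ) : bondWeightSum Λ (cornerBondWeight a) i = 1 := by
  unfold AndersonCluster.bondWeightSum AndersonCluster.bondWeight cornerBondWeight
  rw [Finset.sum_eq_single (a - unitVec i)]
  · rw [sub_add_cancel, if_pos ha, if_pos rfl]
  · intro x _ hne
    have hx : x + unitVec i ≠ a := fun h => hne (by rw [← h, add_sub_cancel_right])
    rw [if_neg hx, ite_self]
  · exact fun h => absurd hai h

/-- The corner site weight is normalised: `Σ_{x ∈ Λ} V x = 1` (`a ∈ Λ`). [cite: Anderson1951, eq. (2)] -/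
theorem siteWeightSum_cornerSiteWeight {Λ : Finset (Site d)} {a : Site d} (ha : a ∈ Λ) :
    siteWeightSum Λ (cornerSiteWeight a) = 1 := by
  unfold AndersonCluster.siteWeightSum cornerSiteWeight
  rw [Finset.sum_ite_eq' Λ a (fun _ => (1 : ℝ)), if_pos ha]

/-- A multiple of the corner site weight sums to the multiple: `Σ_{x ∈ Λ} c · V x = c` (`a ∈ Λ`); with
`c = −μ` this is the chemical-potential normalisation `Σ μ' = −μ`. [cite: Anderson1951, eq. (2)] -/
theorem siteWeightSum_mul_cornerSiteWeight {Λ : Finset (Site d)} {a : Site d} (ha : a ∈ Λ) (c : ℝ) :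
    siteWeightSum Λ (fun x => c * cornerSiteWeight a x) = c := by
  unfold AndersonCluster.siteWeightSum cornerSiteWeight
  simp_rw [mul_ite, mul_one, mul_zero]
  rw [Finset.sum_ite_eq' Λ a (fun _ => c), if_pos ha]

/-- **The corner energy representative** of the window `Λ` with corner `a` at couplings `(t, U)` and
chemical potential `μ`: `h_μ = −t Σ_i hop(a − eᵢ, a) + U n_{a↑}n_{a↓} − μ (n_{a↑} + n_{a↓})`, realised as the
weighted cluster Hamiltonian with corner weights (the `h_μ` of the `hubbard-thermal` C1 certificates,
THEORY.md §2 U3: "each site owns its left and down bonds"). [cite: PoulinHastings2011, eqs. (3)–(8)] -/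
def cornerEnergyRep (Λ : Finset (Site d)) (a : Site d) (t U μ : ℝ) : FermionOp Λ :=
  clusterHamiltonian Λ t U (cornerBondWeight a) (cornerSiteWeight a) (fun x => -μ * cornerSiteWeight a x)

/-- The corner representative is Hermitian. [cite: PoulinHastings2011, eqs. (3)–(8)] -/
theorem isHermitian_cornerEnergyRep (Λ : Finset (Site d)) (a : Site d) (t U μ : ℝ) :
    (cornerEnergyRep Λ a t U μ).IsHermitian :=
  isHermitian_clusterHamiltonian Λ t U _ _ _

end Corner

/-! ### §1. The certified upper bound on the grand-canonical pressure (weighted-cluster representative) -/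

section Certificate

variable {d L : ℕ} [NeZero L]

/-- (Local to this file, as in `HubbardAndersonClusterBound.lean`.) Equality of torus sites is decided through
the linear order — the instance the generic Jordan–Wigner lemmas carry. [folklore] -/
local instance (priority := high) instDecidableEqFermionTorusClusterMarkov : DecidableEq (FermionTorus d L) :=
  LinearOrder.toDecidableEq

omit [NeZero L] in
/-- `H_L(t,U) − μ N_L` on the `d`-torus is Hermitian, every `d` (the tree's `isHermitian_hubbardTorusWith` is the
case `d = 2`). [cite: LiebPRL1989, eq. (1)] -/
theorem isHermitian_hubbardTorusWith_dim (t U μ : ℝ) : (hubbardTorusWith d L t U μ).IsHermitian := by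
  rw [hubbardTorusWith, hamiltonianWith_eq]
  refine (LiebThm1.hamiltonian_isHermitian _ t U).sub ?_
  change ((μ : ℂ) • totalNumber)ᴴ = (μ : ℂ) • totalNumber
  have hN : (totalNumber : Matrix (Finset (Orb (FermionTorus d L))) (Finset (Orb (FermionTorus d L))) ℂ)ᴴ =
      totalNumber := by
    rw [totalNumber_eq_diagonal_card, Matrix.diagonal_conjTranspose]
    congr 1
    funext s
    simp
  rw [Matrix.conjTranspose_smul, Complex.star_def, Complex.conj_ofReal, hN]

omit [NeZero L] in
/-- `H_L(t,U) − μ N_L` on the `d`-torus is even. [cite: ArakiMoriya2003, §4.1 Def. 4.2] -/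
theorem parityAut_hubbardTorusWith (t U μ : ℝ) :
    parityAut (hubbardTorusWith d L t U μ) = hubbardTorusWith d L t U μ := by
  rw [hubbardTorusWith, hamiltonianWith_eq, map_sub, map_smul, parityAut_totalNumber,
    parityAut_eq_self_of_preservesSectors (LiebThm1.preservesSectors_hamiltonian _ t U)]

/-- **Certified Markov upper bound on the grand-canonical pressure of the Hubbard torus, weighted-cluster
form.** Let `L ≥ 3`, `β, μ` real, `K_L = H_L(t,U) − μ N_L` on `(ℤ/Lℤ)^d` (`hubbardTorusWith`),
`ρ_β = e^{−βK_L}/Z` its Gibbs density. Let `Λ ⊆ [0, ℓ)^d` (`ℓ ≤ L`) be a window with lexicographically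
largest site `a`, `ρ_Λ = tr_{𝕋→Λ} ρ_β`, and `h = h(J,V,μ') + G` with `h(J,V,μ')` the weighted cluster
Hamiltonian of `Λ` with NORMALISED weights (`Σ_x J̃(x,i) = 1` for every direction `i`, `Σ V = 1`,
`Σ μ' = −μ`; e.g. the corner representative `U n_{a↑}n_{a↓} − μ n_a − t Σ_i hop(a − eᵢ, a)`) and
`G ∈ 𝔄_Λ` Hermitian of zero expectation in `ρ_Λ` (e.g. a `windowAnnihilator`). If `(L_B, c)` passes the
certificate `e^c · exp(L_B) − tr_{Λ→Λ∖a} exp(−β h + Γ L_B) ⪰ 0`, then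
`log Z_β(K_L) ≤ L^d · c + (L^d − (L+1−ℓ)^d) · (log 4 − c − β · Re tr(ρ_Λ h))`.
The window only needs to carry the weights (a corner `{a, a − e₁, …, a − e_d}` suffices), so the `3 × 2`,
`4 × 2` and staircase shields of the programme's C1 certificates are covered.
[cite: PoulinHastings2011, eqs. (3)–(8)] [cite: Anderson1951, eq. (2)] -/
theorem hubbardWith_log_partitionFn_le_of_clusterCertificate (t U μ β : ℝ) (hL : 3 ≤ L)
    {Λ : Finset (Site d)} {a : Site d} (ha : a ∈ Λ) (hmax : ∀ y ∈ Λ, toLex y ≤ toLex a)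
    {ℓ : ℕ} (hΛ : Λ ⊆ halfOpenBox d ℓ) (hℓL : ℓ ≤ L)
    {J : Site d → Fin d → ℝ} {V μ' : Site d → ℝ}
    (hJ : ∀ i, bondWeightSum Λ J i = 1) (hV : siteWeightSum Λ V = 1) (hμ : siteWeightSum Λ μ' = -μ)
    {G : FermionOp Λ} (hG : G.IsHermitian)
    (hG0 : (fermionPartialTrace (PolySite.toTorusEmb L (injOn_proj_of_subset_halfOpenBox' hΛ hℓL))
      ((partitionFn β (hubbardTorusWith d L t U μ))⁻¹ • gibbsWeight β (hubbardTorusWith d L t U μ)) * G).trace = 0)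
    {LB : FermionOp (Λ.erase a)} (hLB : LB.IsHermitian) {c : ℝ}
    (hcert : ((Real.exp c : ℂ) • cfc Real.exp LB -
      fermionPartialTrace (PolySite.incl (Finset.erase_subset a Λ))
        (cfc Real.exp (-((β : ℂ) • (clusterHamiltonian Λ t U J V μ' + G)) +
          fermionEmbed (PolySite.incl (Finset.erase_subset a Λ)) LB))).PosSemidef) :
    Real.log (partitionFn β (hubbardTorusWith d L t U μ)).re ≤
      ((L : ℝ) ^ d) * c +
        (((L ^ d : ℕ) : ℝ) - (((L + 1 - ℓ) ^ d : ℕ) : ℝ)) *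
          (Real.log 4 - c - β *
            (fermionPartialTrace (PolySite.toTorusEmb L (injOn_proj_of_subset_halfOpenBox' hΛ hℓL))
                ((partitionFn β (hubbardTorusWith d L t U μ))⁻¹ • gibbsWeight β (hubbardTorusWith d L t U μ)) *
              (clusterHamiltonian Λ t U J V μ' + G)).trace.re) := by
  set K : Matrix (Finset (Orb (FermionTorus d L))) (Finset (Orb (FermionTorus d L))) ℂ :=
    hubbardTorusWith d L t U μ with hK
  set h : FermionOp Λ := clusterHamiltonian Λ t U J V μ' + G with hh
  have hKherm : K.IsHermitian := isHermitian_hubbardTorusWith_dim t U μ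
  have hKev : parityAut K = K := parityAut_hubbardTorusWith t U μ
  have hKTI : ∀ w : TorusSite d L, relabel (Orb.translate w) K = K := fun w =>
    relabel_translate_hubbardTorusWith w t U μ
  have hΩ := injOn_proj_of_subset_halfOpenBox' hΛ hℓL
  set ρ := (partitionFn β K)⁻¹ • gibbsWeight β K with hρdef
  have hρTI : ∀ w : TorusSite d L, relabel (Orb.translate w) ρ = ρ := relabel_translate_gibbsDensity L hKTI β
  have hhherm : h.IsHermitian := (isHermitian_clusterHamiltonian Λ t U J V μ').add hG
  have hKh : (ρ * K).trace.re =
      ((L : ℝ) ^ d) * (fermionPartialTrace (PolySite.toTorusEmb L hΩ) ρ * h).trace.re := by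
    have : (ρ * K).trace = ((L : ℂ) ^ d) * (fermionPartialTrace (PolySite.toTorusEmb L hΩ) ρ * h).trace := by
      rw [hK, trace_mul_hubbardTorusWith_eq_cluster hL t U μ hρTI hΩ hJ hV hμ, hh, Matrix.mul_add, Matrix.trace_add,
        hG0, add_zero]
    rw [this, Complex.mul_re, ← Complex.ofReal_natCast, ← Complex.ofReal_pow, Complex.ofReal_re, Complex.ofReal_im,
      zero_mul, sub_zero]
  exact torus_log_partitionFn_le_of_certificate L hKherm hKev hKTI β ha hmax hΛ hℓL hhherm hKh hLB hcert

/-- **The same with a structured annihilator** `G = windowAnnihilator s Λ S hS z hz O g` (Hermitian local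
operators `O_i`): the zero-expectation hypothesis is discharged by `trace_window_mul_windowAnnihilator`, so
the ONLY remaining hypothesis is the matrix certificate. [cite: PoulinHastings2011, eqs. (3)–(8)] -/
theorem hubbardWith_log_partitionFn_le_of_clusterCertificate_annihilator (t U μ β : ℝ) (hL : 3 ≤ L)
    {Λ : Finset (Site d)} {a : Site d} (ha : a ∈ Λ) (hmax : ∀ y ∈ Λ, toLex y ≤ toLex a)
    {ℓ : ℕ} (hΛ : Λ ⊆ halfOpenBox d ℓ) (hℓL : ℓ ≤ L)
    {J : Site d → Fin d → ℝ} {V μ' : Site d → ℝ}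
    (hJ : ∀ i, bondWeightSum Λ J i = 1) (hV : siteWeightSum Λ V = 1) (hμ : siteWeightSum Λ μ' = -μ)
    {ι : Type*} (s : Finset ι) (S : ι → Finset (Site d)) (hS : ∀ i, S i ⊆ Λ) (z : ι → Site d)
    (hz : ∀ i, shiftSet (z i) (S i) ⊆ Λ) {O : ∀ i, FermionOp (S i)} (hO : ∀ i ∈ s, (O i).IsHermitian)
    (g : ι → ℝ)
    {LB : FermionOp (Λ.erase a)} (hLB : LB.IsHermitian) {c : ℝ}
    (hcert : ((Real.exp c : ℂ) • cfc Real.exp LB -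
      fermionPartialTrace (PolySite.incl (Finset.erase_subset a Λ))
        (cfc Real.exp (-((β : ℂ) • (clusterHamiltonian Λ t U J V μ' + windowAnnihilator s Λ S hS z hz O g)) +
          fermionEmbed (PolySite.incl (Finset.erase_subset a Λ)) LB))).PosSemidef) :
    Real.log (partitionFn β (hubbardTorusWith d L t U μ)).re ≤
      ((L : ℝ) ^ d) * c +
        (((L ^ d : ℕ) : ℝ) - (((L + 1 - ℓ) ^ d : ℕ) : ℝ)) *
          (Real.log 4 - c - β *
            (fermionPartialTrace (PolySite.toTorusEmb L (injOn_proj_of_subset_halfOpenBox' hΛ hℓL))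
                ((partitionFn β (hubbardTorusWith d L t U μ))⁻¹ • gibbsWeight β (hubbardTorusWith d L t U μ)) *
              (clusterHamiltonian Λ t U J V μ' + windowAnnihilator s Λ S hS z hz O g)).trace.re) := by
  have hKTI : ∀ w : TorusSite d L, relabel (Orb.translate w) (hubbardTorusWith d L t U μ) = hubbardTorusWith d L t U μ :=
    fun w => relabel_translate_hubbardTorusWith w t U μ
  exact hubbardWith_log_partitionFn_le_of_clusterCertificate t U μ β hL ha hmax hΛ hℓL hJ hV hμ
    (isHermitian_windowAnnihilator s Λ S hS z hz hO g)
    (trace_window_mul_windowAnnihilator (relabel_translate_gibbsDensity L hKTI β) _ s S hS z hz O g) hLB hcert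

/-- **Corner form** (the programme's `h_μ`): if the window contains the corner `a` (its lexicographically
largest site) together with `a − eᵢ` for every direction `i`, then for `h = h_μ + G` with
`h_μ = cornerEnergyRep Λ a t U μ` and `G` Hermitian of zero window expectation, the certificate
`e^c · exp(L_B) − tr_{Λ→Λ∖a} exp(−β h + Γ L_B) ⪰ 0` gives
`log Z_β(H_L − μN_L) ≤ L^d c + (L^d − (L+1−ℓ)^d)(log 4 − c − β Re tr(ρ_Λ h))`.
[cite: PoulinHastings2011, eqs. (3)–(8)] -/
theorem hubbardWith_log_partitionFn_le_of_cornerCertificate (t U μ β : ℝ) (hL : 3 ≤ L)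
    {Λ : Finset (Site d)} {a : Site d} (ha : a ∈ Λ) (hmax : ∀ y ∈ Λ, toLex y ≤ toLex a)
    (hcorner : ∀ i : Fin d, a - unitVec i ∈ Λ)
    {ℓ : ℕ} (hΛ : Λ ⊆ halfOpenBox d ℓ) (hℓL : ℓ ≤ L)
    {G : FermionOp Λ} (hG : G.IsHermitian)
    (hG0 : (fermionPartialTrace (PolySite.toTorusEmb L (injOn_proj_of_subset_halfOpenBox' hΛ hℓL))
      ((partitionFn β (hubbardTorusWith d L t U μ))⁻¹ • gibbsWeight β (hubbardTorusWith d L t U μ)) * G).trace = 0)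
    {LB : FermionOp (Λ.erase a)} (hLB : LB.IsHermitian) {c : ℝ}
    (hcert : ((Real.exp c : ℂ) • cfc Real.exp LB -
      fermionPartialTrace (PolySite.incl (Finset.erase_subset a Λ))
        (cfc Real.exp (-((β : ℂ) • (cornerEnergyRep Λ a t U μ + G)) +
          fermionEmbed (PolySite.incl (Finset.erase_subset a Λ)) LB))).PosSemidef) :
    Real.log (partitionFn β (hubbardTorusWith d L t U μ)).re ≤
      ((L : ℝ) ^ d) * c +
        (((L ^ d : ℕ) : ℝ) - (((L + 1 - ℓ) ^ d : ℕ) : ℝ)) *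
          (Real.log 4 - c - β *
            (fermionPartialTrace (PolySite.toTorusEmb L (injOn_proj_of_subset_halfOpenBox' hΛ hℓL))
                ((partitionFn β (hubbardTorusWith d L t U μ))⁻¹ • gibbsWeight β (hubbardTorusWith d L t U μ)) *
              (cornerEnergyRep Λ a t U μ + G)).trace.re) :=
  hubbardWith_log_partitionFn_le_of_clusterCertificate t U μ β hL ha hmax hΛ hℓL
    (fun i => bondWeightSum_cornerBondWeight ha (hcorner i)) (siteWeightSum_cornerSiteWeight ha)
    (siteWeightSum_mul_cornerSiteWeight ha (-μ)) hG hG0 hLB hcert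

end Certificate

/-! ### §2. The square lattice at `t' = 0`: the object of the torus-limit files -/

section Square

variable {L : ℕ} [NeZero L]

/-- (Local, as in §1.) [folklore] -/
local instance (priority := high) instDecidableEqFermionTorusClusterMarkovSq : DecidableEq (FermionTorus 2 L) :=
  LinearOrder.toDecidableEq

omit [NeZero L] in
/-- At `t' = 0` the grand-canonical `t–t'` torus Hamiltonian is the grand-canonical Hubbard torus Hamiltonian:
`H^{t,0}_L − μ N_L = hubbardTorusWith 2 L t U μ`. [cite: XuEtAl2024, eq. (1)] -/
theorem hubbardTorusTT'_zero_sub_mu (t U μ : ℝ) :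
    hubbardTorusTT' L t 0 U - (μ : ℂ) • totalNumber = hubbardTorusWith 2 L t U μ := by
  rw [hubbardTorusTT'_zero, hubbardTorusWith, hamiltonianWith_eq, hubbardTorus]

/-- **Certified Markov upper bound on the grand-canonical pressure of the square-lattice Hubbard torus
(`t' = 0`), weighted-cluster form** — the statement consumed by the torus-limit assembly
(`HubbardTorusMarkovPressureTorusLimit.lean` pattern): for `K_L = H^{t,0}_L − μ N_L` (`L ≥ 3`), a window
`Λ ⊆ [0,ℓ)²` with lexicographically largest site `a` (`Pi.Lex`: coordinate `0` major — for the programme's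
raster order take coordinate `0` = row, coordinate `1` = column), normalised weights `(J, V, μ')`, a Hermitian
`G ∈ 𝔄_Λ` of zero window expectation and a certificate `(L_B, c)`:
`log Z_β(K_L) ≤ L² c + (L² − (L+1−ℓ)²)(log 4 − c − β Re tr(ρ_Λ (h(J,V,μ') + G)))`.
[cite: PoulinHastings2011, eqs. (3)–(8)] -/
theorem hubbardTTPrime_zero_log_partitionFn_le_of_clusterCertificate (t U μ β : ℝ) (hL : 3 ≤ L)
    {Λ : Finset (Site 2)} {a : Site 2} (ha : a ∈ Λ) (hmax : ∀ y ∈ Λ, toLex y ≤ toLex a)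
    {ℓ : ℕ} (hΛ : Λ ⊆ halfOpenBox 2 ℓ) (hℓL : ℓ ≤ L)
    {J : Site 2 → Fin 2 → ℝ} {V μ' : Site 2 → ℝ}
    (hJ : ∀ i, bondWeightSum Λ J i = 1) (hV : siteWeightSum Λ V = 1) (hμ : siteWeightSum Λ μ' = -μ)
    {G : FermionOp Λ} (hG : G.IsHermitian)
    (hG0 : (fermionPartialTrace (PolySite.toTorusEmb L (injOn_proj_of_subset_halfOpenBox' hΛ hℓL))
      ((partitionFn β (hubbardTorusTT' L t 0 U - (μ : ℂ) • totalNumber))⁻¹ •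
        gibbsWeight β (hubbardTorusTT' L t 0 U - (μ : ℂ) • totalNumber)) * G).trace = 0)
    {LB : FermionOp (Λ.erase a)} (hLB : LB.IsHermitian) {c : ℝ}
    (hcert : ((Real.exp c : ℂ) • cfc Real.exp LB -
      fermionPartialTrace (PolySite.incl (Finset.erase_subset a Λ))
        (cfc Real.exp (-((β : ℂ) • (clusterHamiltonian Λ t U J V μ' + G)) +
          fermionEmbed (PolySite.incl (Finset.erase_subset a Λ)) LB))).PosSemidef) :
    Real.log (partitionFn β (hubbardTorusTT' L t 0 U - (μ : ℂ) • totalNumber)).re ≤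
      ((L : ℝ) ^ 2) * c +
        (((L ^ 2 : ℕ) : ℝ) - (((L + 1 - ℓ) ^ 2 : ℕ) : ℝ)) *
          (Real.log 4 - c - β *
            (fermionPartialTrace (PolySite.toTorusEmb L (injOn_proj_of_subset_halfOpenBox' hΛ hℓL))
                ((partitionFn β (hubbardTorusTT' L t 0 U - (μ : ℂ) • totalNumber))⁻¹ •
                  gibbsWeight β (hubbardTorusTT' L t 0 U - (μ : ℂ) • totalNumber)) *
              (clusterHamiltonian Λ t U J V μ' + G)).trace.re) := by
  rw [hubbardTorusTT'_zero_sub_mu] at hG0 ⊢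
  exact hubbardWith_log_partitionFn_le_of_clusterCertificate t U μ β hL ha hmax hΛ hℓL hJ hV hμ hG hG0 hLB hcert

end Square

end Literature.MathematicalPhysics.QuantumLattice

end
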